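import Literature.MathematicalPhysics.QuantumFieldTheory.Balaban1983to89.B12Rep537

/-!
# `Balaban1983to89.B12Transverse536` — [Balaban1987RG1] §5 pp. 293–297: the symmetries (5.7)/(5.13)
(reflections), (5.6)/(5.12) (permutations) and the first Ward identity (5.9)/(5.15), together with the decay
(5.10), FORCE the second-order Taylor data (5.16)/(5.36) of every component `Π_{μν}` to be `β ×` those of
`δ_{μν}Δ(p) − \overline{∂_μ(p)}∂_ν(p)` with the single constant `β = Σ_x Π_{μ₀ν₀}(x)x_{μ₀}x_{ν₀}` (any `μ₀ ≠ ν₀`) —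
typed and proved on the COEFFICIENT (position-space) side, by a parity argument in bond-midpoint coordinates plus
the Ward identity paired with monomial test functions; corollary: (5.7) + (5.6) + (5.9)₁ + (5.10) ⇒ the
representation (5.37)/(5.38) with the decay (5.44) for all `μ, ν` (via `B12Rep537.rep538_of_decay510`)

CITATION HEADER (lean-in-tree rule 2026-08-18).  Source: T. Bałaban, *Renormalization group approach to lattice
gauge field theories. I. Generation of effective actions in a small field approximation and a coupling constant
renormalization in four dimensions*, Commun. Math. Phys. **109**, 249–301 (1987), doi:10.1007/bf01215223
[Balaban1987RG1] (held: `paper:balaban1987-cmp109-rg-i-small-field`; journal page = PDF page + 248).  The displays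
quoted below were READ FROM THE 300-dpi PAGE RENDER of p. 293 [PDF 45]
(`HOME/b2b-balaban-ref1/pages/1987-cmp109-rg-I-small-field/1987-cmp109-rg-I-small-field-p045-x2.png`) and agree
with the audited lineage transcript `HOME/b2b-balaban-b03/B12s-transcript.md` (b03 gen 1).  Audit cell
`pub-balaban`, unit `b2b-balaban-b03-g6` (B12 §§2–5 lineage), node B12-SYM536-COEFF; it sits on top of
`…Balaban1983to89.B12Rep537` (same unit: (5.36) ⇒ (5.37)/(5.38)/(5.44), (5.42)) whose displayed hypothesis
`TaylorData3 β μ ν Π` it DISCHARGES from the printed symmetries.  Value = typed statement + kernel certificate of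
the content of B12's sentence "We will analyze this function using the above properties only" (p. 293, after
(5.15)) as far as the SECOND-ORDER data (5.16)/(5.36) and the value (5.42) of β are concerned; it is INDEPENDENT of
the Laurent-splitting computation (5.17)–(5.35) of pp. 294–297 (whose finite jet algebra the b12 lineage certified
in `…Balaban1983to89.B12Sec5Algebra`, with the located slip recorded there), so it is a second, independent route
to (5.36)'s quadratic part.  NOT summit progress; NOTHING is asserted about the sign or size of β (cell GAPS
G-B12s-*, G-adv2-3): β is identified, as in (5.42)/(1.22), with the second moment `B12Beta.secondMoment`, whatever
its value.

THE PRINTED TEXT (verbatim, p. 293).  NOTATION (v1.1, DOCFIX G-ref5-91 (referee-b2b-balaban-ref5-g11, XREAD #91)): the print writes Π_{μν}(p), Π_{μν}(ζ), Π′_{μν}(p) WITHOUT a tilde for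
the momentum-space function of (5.11) (renders p045/p049/p050 re-read as images); inside quotation marks this header now
follows the print exactly; OUTSIDE quotation marks Π̃, Π̃′ (tilde ours) denote the momentum-space functions, to keep them
apart from the position-space kernel Π_{μν}(x).  v1 → v1.1: docstrings only; every Lean declaration byte-unchanged.
* "If r is a reflection in a part of the components of x: rx = εx, (εx)_μ = ε_μx_μ, ε_μ = ±1, μ = 1, …, d, then
  (5.4) can be written as Π(⟨εx, εx + ε_μe_μ⟩, ⟨εy, εy + ε_νe_ν⟩) = Π(⟨x, x + e_μ⟩, ⟨y, y + e_ν⟩). This and the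
  definition (5.5) yield" (5.7) "Π_{μν}(εx − ((1−ε_μ)/2)e_μ, εy − ((1−ε_ν)/2)e_ν) = ε_με_νΠ_{μν}(x, y)."
* "The function Π is also translation invariant and symmetric, hence" (5.8) "Π_{μν}(x, y) = Π_{μν}(x − y),
  Π_{μν}(x) = Π_{νμ}(−x)."
* "The gauge invariance, expressed in the first identity (4.15), implies" (5.9)
  "Σ_μ ∂*_μΠ_{μν}(x − y) = Σ_ν ∂_νΠ_{μν}(x − y) = 0."
* (5.10) "|Π_{μν}(x − y)| ≤ O(1)E₀ exp(−δ₁|x − y|)"; (5.11) "Π_{μν}(p) = Σ_{x∈Z⁴} e^{−ip·x}Π_{μν}(x)"; "Let us write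
  the symmetry properties (5.6)–(5.9) for the function Π_{μν}(ζ):" (5.12) "Π_{μν}(rζ) = ((r⊗r)Π)_{μν}(ζ) if r is a
  permutation," (5.13) "Π_{μν}(εζ) = ε_με_ν exp(−i((1−ε_μ)/2)ζ_μ) exp(i((1−ε_ν)/2)ζ_ν) Π_{μν}(ζ)," (5.14)
  "Π_{μν}(ζ) = Π_{νμ}(−ζ)," (5.15) "Σ_μ ∂_μ(−ζ)Π_{μν}(ζ) = Σ_ν ∂_ν(ζ)Π_{μν}(ζ) = 0, where ∂_μ(ζ) = e^{iζ_μ} − 1.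
  We will analyze this function using the above properties only. Our goal is to prove a representation of the form
  (4.41), more exactly of the form" (5.16) "Π_{μν}(p) = β(δ_{μν}Δ(p) − \overline{∂_μ(p)}∂_ν(p)) + (terms of higher
  orders in derivatives ∂(p), \overline{∂(p)}), and to find the coefficient β."
* (5.6) p. 292 (transcript): "Π_{μν}(rx, ry) = Π_{π⁻¹(μ),π⁻¹(ν)}(x, y) = ((r⊗r)Π)_{μν}(x, y)", (rx)_μ = x_{π⁻¹(μ)}.

THE TYPING (position space, difference variable `u = x − y` of (5.8); the dictionary coefficient ↔ symbol is the
one of `B12Rep537`: symbol = `genFun Π w`, `w = e^{−iζ}`; `\overline{∂_μ} = ∂_μ(−ζ) ↔ PeriodicGleason.delta μ`).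
* (5.7) in the difference variable: with `x' = εx − ((1−ε_μ)/2)e_μ`, `y' = εy − ((1−ε_ν)/2)e_ν` one has
  `x' − y' = εu − ((1−ε_μ)/2)e_μ + ((1−ε_ν)/2)e_ν`; for the reflection of the single axis `ρ` (`ε_ρ = −1`, all other
  `ε_j = +1`; these generate all ε) `(1−ε_μ)/2 = [μ = ρ]`, so (5.7) reads `Π_{μν}(R_{ρ;μν}u) = ε_με_ν Π_{μν}(u)` with
  `(R_{ρ;μν}u)_ρ = −u_ρ − [μ=ρ] + [ν=ρ]`, `(R_{ρ;μν}u)_j = u_j (j ≠ ρ)` and `ε_μ = −1 iff μ = ρ`: this is `reflTwist` /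
  `ReflCovariant` below (an involution, `reflTwist_reflTwist`).  CHECK against (5.13): substituting `u = R v` in
  (5.11) gives `Π̃_{μν}(εp) = ε_με_ν e^{−i[μ=ρ]p_μ} e^{i[ν=ρ]p_ν} Π̃_{μν}(p)`, which is (5.13) — so the typed
  hypothesis is exactly the printed one.
* (5.6)/(5.12): `B12Beta.PermCovariant` (already in the tree: `Π_{σμ,σν}(u∘σ⁻¹) = Π_{μν}(u)`), used only through
  `B12Beta.secondMoment_pair_indep` (isotropy of the off-diagonal second moment).
* (5.9)/(5.15), FIRST identity only: `Σ_μ ∂*_μ Π_{μν} = 0`, typed `WardFirst`: `∀ ν u, Σ_μ (Π_{μν}(u − e_μ) − Π_{μν}(u)) =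
  0`, i.e. `Σ_μ PeriodicGleason.delta μ Π_{μν} = 0`, whose symbol is (5.15)'s `Σ_μ ∂_μ(−ζ)Π̃_{μν}(ζ) = 0` under the
  dictionary (the orientation of the difference is immaterial for everything below: the forward version yields the
  same moment relations).  The second identities of (5.8) and (5.9) are NOT used.
* (5.10): the cell's `B12Sec2to5.Decay510 (Π μ ν) C δ₁` for every component.
* Conclusion = `B12Rep537.TaylorData3 β μ ν (ofReal (Π μ ν))` for EVERY `μ ν`, `β = B12Beta.secondMoment Π μ₀ ν₀`
  (`μ₀ ≠ ν₀` arbitrary; d ≥ 2 implicitly through their existence): all monomial moments of order ≤ 2 of `Π_{μν}`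
  are `β ×` those of `wilsonQ μ ν` — which is what "(5.16) with THIS β, up to terms of higher orders" means on the
  coefficient side (see `B12Rep537`'s header for the one standard passage symbol ↔ moments not formalised).

THE PROOF (ours — B12 proves (5.36) differently, by the Laurent splitting; every step kernel-checked, [folklore]
lattice-symmetry / transversality bookkeeping).  Moments `m₀ = ΣΠ`, `m₁(κ) = ΣΠu_κ`, `m₂(κ,λ) = ΣΠu_κu_λ` of a
component `Π = Π_{μν}` (absolutely convergent by (5.10), `PolyBound.summable_mul`).  (W) Pairing the Ward identity
with a polynomially bounded test function φ (summation by parts `mom_delta`): `Σ_μ Σ_u Π_{μν}(u)(φ(u+e_μ) − φ(u)) =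
0` (`ward_pair`); φ = u_κ gives `m₀(Π_{κν}) = 0` for all κ, ν (`m0_eq_zero_of_ward`); φ = u_κu_λu_τ gives the cyclic
relation `m₂(Π_{κν})(λ,τ) + m₂(Π_{λν})(κ,τ) + m₂(Π_{τν})(κ,λ) = 0` (`ward_m2`).  (P) In the doubled bond-midpoint
coordinates `X_κ(u) = 2u_κ + [κ=μ] − [κ=ν]` one has `X_κ(R_{ρ;μν}u) = ε_κ X_κ(u)` (`X_reflTwist`), so re-indexing the
lattice sum by the involution `R_{ρ;μν}` and using (5.7) multiplies `ΣΠ_{μν}X_κ` by `ε_με_νε_κ` and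
`ΣΠ_{μν}X_κX_λ` by `ε_με_νε_κε_λ`; choosing ρ so that this sign is −1 kills them: `m₁ ≡ 0` always
(`momX_eq_zero`), and `m₂(Π_{μν})(κ,λ) = 0` unless the indices pair up as (μ=ν, κ=λ), (μ=κ, ν=λ) or (μ=λ, ν=κ)
(`momXX_eq_zero`).  (A) The cyclic relation at (a,a,a,a) gives `m₂(Π_{aa})(a,a) = 0`, at (a,a,b,b)
`m₂(Π_{bb})(a,a) = −2 m₂(Π_{ab})(a,b)`, and permutation covariance makes `m₂(Π_{ab})(a,b) = β` for all `a ≠ b`;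
the resulting table is `m₂(Π_{μν})(κ,λ) = β(−2δ_{μν}δ_{κλ} + δ_{μκ}δ_{νλ} + δ_{μλ}δ_{νκ})` (`table536`) = β × the
table of `wilsonQ μ ν` (`B12Rep537.tsum_wilsonQ_mul_coord2`), whence `TaylorData3` by the classification of the
monomials of degree ≤ 2 (`monom_cases`, `taylorData3_of_moments`).

WHAT THIS MODULE DOES NOT CLAIM.  (5.7), (5.6), (5.9), (5.10) themselves (properties of Bałaban's Π derived on
pp. 291–293 from (5.1)–(5.5), (4.15), (4.37)) are HYPOTHESES, displayed in every signature; the higher-order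
structure of (5.36)/(5.38) beyond order two is `B12Rep537`'s business; d = 4 is not needed and not assumed.
-/

namespace Literature.MathematicalPhysics.QuantumFieldTheory.Balaban1983to89.B12Transverse536

noncomputable section

open Literature.MathematicalPhysics.QuantumFieldTheory.GawedzkiKupiainen1985.PeriodicGleason
open Literature.MathematicalPhysics.QuantumFieldTheory.Balaban1983to89.B12Rep537

variable {d : ℕ}

/-! ## §1. Polynomially bounded test functions and the moment functional -/

/-- `1 ≤ Π_j(|n_j|+1)^p`. [folklore] -/
theorem one_le_pw (p : ℕ) (x : Pt d) : 1 ≤ pw p x := by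
  unfold pw
  calc (1 : ℝ) = ∏ _j : Fin d, (1 : ℝ) := by simp
    _ ≤ ∏ j, (|(x j : ℝ)| + 1) ^ p :=
        Finset.prod_le_prod (fun _ _ => zero_le_one) fun j _ =>
          one_le_pow₀ (by linarith [abs_nonneg (x j : ℝ)])

/-- `pw p · pw q = pw (p+q)`. [folklore] -/
theorem pw_mul_pw (p q : ℕ) (x : Pt d) : pw p x * pw q x = pw (p + q) x := by
  unfold pw
  rw [← Finset.prod_mul_distrib]
  exact Finset.prod_congr rfl fun j _ => (pow_add _ _ _).symm

/-- `pw` is monotone in the exponent. [folklore] -/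
theorem pw_mono {p q : ℕ} (h : p ≤ q) (x : Pt d) : pw p x ≤ pw q x := by
  unfold pw
  exact Finset.prod_le_prod (fun j _ => by positivity) fun j _ =>
    pow_le_pow_right₀ (by linarith [abs_nonneg (x j : ℝ)]) h

/-- A shift by a vector with entries in `{-1,0,1}` costs at most the factor `2^{pd}` in `pw p`. [folklore] -/
theorem pw_shift_le (p : ℕ) (x s : Pt d) (hs : ∀ j, |(s j : ℝ)| ≤ 1) :
    pw p (x + s) ≤ (2 ^ p) ^ d * pw p x := by
  unfold pw
  have e : ((2 : ℝ) ^ p) ^ d * ∏ j, (|(x j : ℝ)| + 1) ^ p = ∏ j : Fin d, ((2 : ℝ) ^ p * (|(x j : ℝ)| + 1) ^ p) := by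
    rw [Finset.prod_mul_distrib, Finset.prod_const, Finset.card_univ, Fintype.card_fin]
  rw [e]
  refine Finset.prod_le_prod (fun j _ => by positivity) fun j _ => ?_
  rw [← mul_pow]
  apply pow_le_pow_left₀ (by positivity)
  have h1 : |(((x + s) j : ℤ) : ℝ)| ≤ |(x j : ℝ)| + 1 := by
    simp only [Pi.add_apply, Int.cast_add]
    exact (abs_add_le _ _).trans (by linarith [hs j])
  linarith [abs_nonneg (x j : ℝ)]

/-- `|(e_μ)_j| ≤ 1`. [folklore] -/
theorem abs_unitVec_le (μ j : Fin d) : |(((unitVec μ) j : ℤ) : ℝ)| ≤ 1 := by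
  unfold unitVec
  split_ifs <;> simp

/-- Polynomially bounded test functions: `|φ(n)| ≤ C Π_j(|n_j|+1)^p`. [folklore] -/
def PolyBound (φ : Pt d → ℂ) : Prop := ∃ C : ℝ, ∃ p : ℕ, ∀ x, ‖φ x‖ ≤ C * pw p x

/-- A polynomial bound may be taken with a non-negative constant. [folklore] -/
theorem PolyBound.bound_nonneg {φ : Pt d → ℂ} (h : PolyBound φ) :
    ∃ C : ℝ, ∃ p : ℕ, 0 ≤ C ∧ ∀ x, ‖φ x‖ ≤ C * pw p x := by
  obtain ⟨C, p, h⟩ := h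
  exact ⟨|C|, p, abs_nonneg C, fun x =>
    (h x).trans (mul_le_mul_of_nonneg_right (le_abs_self C) (pw_pos p x).le)⟩

/-- An exponentially decaying kernel times a polynomially bounded test function is absolutely summable.
[folklore] -/
theorem PolyBound.summable_mul {φ : Pt d → ℂ} (h : PolyBound φ) {a M : ℝ} {c : Pt d → ℂ}
    (hc : ExpBound a M c) (ha : 0 < a) : Summable fun x => c x * φ x := by
  obtain ⟨C, p, h⟩ := h
  exact hc.summable_mul ha h

/-- Constants are polynomially bounded. [folklore] -/
theorem polyBound_const (k : ℂ) : PolyBound fun _ : Pt d => k := ⟨‖k‖, 0, fun x => by simp⟩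

/-- Monomials are polynomially bounded. [folklore] -/
theorem polyBound_monom (γ : Fin d → ℕ) : PolyBound (monom γ) :=
  ⟨1, deg γ, fun x => norm_monom_le γ (le_deg γ) x⟩

/-- The multi-index `e_κ`. [folklore] -/
def ind (κ : Fin d) : Fin d → ℕ := fun j => if j = κ then 1 else 0

/-- `x^{e_κ} = x_κ`. [folklore] -/
theorem monom_ind (κ : Fin d) (x : Pt d) : monom (ind κ) x = (x κ : ℂ) := by
  unfold monom ind
  rw [Finset.prod_eq_single κ]
  · simp
  · intro j _ hj; simp [hj]
  · simp

/-- Coordinates are polynomially bounded. [folklore] -/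
theorem polyBound_coord (κ : Fin d) : PolyBound fun x : Pt d => ((x κ : ℤ) : ℂ) := by
  have e : (fun x : Pt d => ((x κ : ℤ) : ℂ)) = monom (ind κ) := funext fun x => (monom_ind κ x).symm
  rw [e]
  exact polyBound_monom _

/-- `δ_{ii} = 1`. [folklore] -/
theorem kron_self (i : Fin d) : kron i i = 1 := if_pos rfl

/-- `δ_{ij} = 0` for `i ≠ j`. [folklore] -/
theorem kron_of_ne {i j : Fin d} (h : i ≠ j) : kron i j = 0 := if_neg h

/-- Sums of polynomially bounded functions are polynomially bounded. [folklore] -/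
theorem PolyBound.add {φ ψ : Pt d → ℂ} (hφ : PolyBound φ) (hψ : PolyBound ψ) :
    PolyBound fun x => φ x + ψ x := by
  obtain ⟨C, p, hC0, hC⟩ := hφ.bound_nonneg
  obtain ⟨D, q, hD0, hD⟩ := hψ.bound_nonneg
  refine ⟨C + D, p + q, fun x => ?_⟩
  calc ‖φ x + ψ x‖ ≤ ‖φ x‖ + ‖ψ x‖ := norm_add_le _ _
    _ ≤ C * pw p x + D * pw q x := add_le_add (hC x) (hD x)
    _ ≤ C * pw (p + q) x + D * pw (p + q) x :=
        add_le_add (mul_le_mul_of_nonneg_left (pw_mono (Nat.le_add_right p q) x) hC0)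
          (mul_le_mul_of_nonneg_left (pw_mono (Nat.le_add_left q p) x) hD0)
    _ = (C + D) * pw (p + q) x := by ring

/-- Scalar multiples of polynomially bounded functions are polynomially bounded. [folklore] -/
theorem PolyBound.const_mul {φ : Pt d → ℂ} (hφ : PolyBound φ) (k : ℂ) : PolyBound fun x => k * φ x := by
  obtain ⟨C, p, hC⟩ := hφ
  refine ⟨‖k‖ * C, p, fun x => ?_⟩
  rw [norm_mul, mul_assoc]
  exact mul_le_mul_of_nonneg_left (hC x) (norm_nonneg k)

/-- Negatives of polynomially bounded functions are polynomially bounded. [folklore] -/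
theorem PolyBound.neg {φ : Pt d → ℂ} (hφ : PolyBound φ) : PolyBound fun x => -φ x := by
  obtain ⟨C, p, hC⟩ := hφ
  exact ⟨C, p, fun x => by rw [norm_neg]; exact hC x⟩

/-- Differences of polynomially bounded functions are polynomially bounded. [folklore] -/
theorem PolyBound.sub {φ ψ : Pt d → ℂ} (hφ : PolyBound φ) (hψ : PolyBound ψ) :
    PolyBound fun x => φ x - ψ x := by
  have h := hφ.add hψ.neg
  simp only [← sub_eq_add_neg] at h
  exact h

/-- Products of polynomially bounded functions are polynomially bounded. [folklore] -/
theorem PolyBound.mul {φ ψ : Pt d → ℂ} (hφ : PolyBound φ) (hψ : PolyBound ψ) :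
    PolyBound fun x => φ x * ψ x := by
  obtain ⟨C, p, hC0, hC⟩ := hφ.bound_nonneg
  obtain ⟨D, q, hD0, hD⟩ := hψ.bound_nonneg
  refine ⟨C * D, p + q, fun x => ?_⟩
  rw [norm_mul]
  calc ‖φ x‖ * ‖ψ x‖ ≤ (C * pw p x) * (D * pw q x) :=
        mul_le_mul (hC x) (hD x) (norm_nonneg _) (mul_nonneg hC0 (pw_pos p x).le)
    _ = C * D * pw (p + q) x := by rw [← pw_mul_pw]; ring

/-- Shifts (by a vector with entries in `{-1,0,1}`) of polynomially bounded functions are polynomially bounded.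
[folklore] -/
theorem PolyBound.shift {φ : Pt d → ℂ} (hφ : PolyBound φ) (s : Pt d) (hs : ∀ j, |(s j : ℝ)| ≤ 1) :
    PolyBound fun x => φ (x + s) := by
  obtain ⟨C, p, hC0, hC⟩ := hφ.bound_nonneg
  refine ⟨C * (2 ^ p) ^ d, p, fun x => ?_⟩
  calc ‖φ (x + s)‖ ≤ C * pw p (x + s) := hC _
    _ ≤ C * ((2 ^ p) ^ d * pw p x) := mul_le_mul_of_nonneg_left (pw_shift_le p x s hs) hC0
    _ = C * (2 ^ p) ^ d * pw p x := by ring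

/-- The moment functional `⟨c, φ⟩ = Σ_n c(n)φ(n)`. [folklore] -/
def mom (c φ : Pt d → ℂ) : ℂ := ∑' x, c x * φ x

/-- The second moments `m₂(c)(κ,τ) = Σ_n c(n) n_κ n_τ`. [cite: Balaban1987RG1, (5.42) p.297 / (1.22) p.264] -/
def m2 (c : Pt d → ℂ) (κ τ : Fin d) : ℂ := mom c fun x => (x κ : ℂ) * (x τ : ℂ)

/-- Linearity of the moment functional (sums; needs absolute convergence). [folklore] -/
theorem mom_add {a M : ℝ} (ha : 0 < a) {c : Pt d → ℂ} (hc : ExpBound a M c) {φ ψ : Pt d → ℂ}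
    (hφ : PolyBound φ) (hψ : PolyBound ψ) : mom c (fun x => φ x + ψ x) = mom c φ + mom c ψ := by
  unfold mom
  rw [← (hφ.summable_mul hc ha).tsum_add (hψ.summable_mul hc ha)]
  exact tsum_congr fun x => mul_add _ _ _

/-- Linearity of the moment functional (differences). [folklore] -/
theorem mom_sub {a M : ℝ} (ha : 0 < a) {c : Pt d → ℂ} (hc : ExpBound a M c) {φ ψ : Pt d → ℂ}
    (hφ : PolyBound φ) (hψ : PolyBound ψ) : mom c (fun x => φ x - ψ x) = mom c φ - mom c ψ := by
  unfold mom
  rw [← (hφ.summable_mul hc ha).tsum_sub (hψ.summable_mul hc ha)]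
  exact tsum_congr fun x => mul_sub _ _ _

/-- Linearity of the moment functional (scalars; unconditional). [folklore] -/
theorem mom_const_mul (c : Pt d → ℂ) (k : ℂ) (φ : Pt d → ℂ) : mom c (fun x => k * φ x) = k * mom c φ := by
  unfold mom
  rw [← tsum_mul_left]
  exact tsum_congr fun x => by ring

/-- A shift `n ↦ n − e_μ` of the argument costs the factor `e^a` in an exponential bound. [folklore] -/
theorem expBound_shift_sub {a M : ℝ} (ha : 0 < a) {c : Pt d → ℂ} (hc : ExpBound a M c) (μ : Fin d) :
    ExpBound a (M * Real.exp a) (fun n => c (n - unitVec μ)) := by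
  intro n
  have h1 : wt a (n - unitVec μ) ≤ Real.exp a * wt a n := by
    rw [wt, wt, ← Real.exp_add]
    exact Real.exp_le_exp.mpr (by nlinarith [l1_sub_unitVec_ge n μ, ha.le])
  calc ‖c (n - unitVec μ)‖ ≤ M * wt a (n - unitVec μ) := hc _
    _ ≤ M * (Real.exp a * wt a n) := mul_le_mul_of_nonneg_left h1 hc.nonneg
    _ = M * Real.exp a * wt a n := by ring

/-- **Summation by parts**: `⟨Δ*_μ c, φ⟩ = ⟨c, φ(· + e_μ)⟩ − ⟨c, φ⟩` for a decaying kernel and a polynomially bounded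
test function. [folklore] -/
theorem mom_delta {a M : ℝ} (ha : 0 < a) {c : Pt d → ℂ} (hc : ExpBound a M c) {φ : Pt d → ℂ}
    (hφ : PolyBound φ) (μ : Fin d) :
    mom (delta μ c) φ = mom c (fun x => φ (x + unitVec μ)) - mom c φ := by
  have hs1 : Summable fun x => c (x - unitVec μ) * φ x := hφ.summable_mul (expBound_shift_sub ha hc μ) ha
  have hs2 : Summable fun x => c x * φ x := hφ.summable_mul hc ha
  have hshift : ∑' x, c (x - unitVec μ) * φ x = ∑' y, c y * φ (y + unitVec μ) :=
    calc ∑' x, c (x - unitVec μ) * φ x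
        = ∑' y, c (y + unitVec μ - unitVec μ) * φ (y + unitVec μ) :=
          ((Equiv.addRight (unitVec μ)).tsum_eq (fun x => c (x - unitVec μ) * φ x)).symm
      _ = ∑' y, c y * φ (y + unitVec μ) := tsum_congr fun y => by rw [add_sub_cancel_right]
  unfold mom
  calc ∑' x, delta μ c x * φ x = ∑' x, (c (x - unitVec μ) * φ x - c x * φ x) :=
        tsum_congr fun x => by rw [delta, sub_mul]
    _ = ∑' x, c (x - unitVec μ) * φ x - ∑' x, c x * φ x := hs1.tsum_sub hs2
    _ = _ := by rw [hshift]

/-! ## §2. The first Ward identity (5.9)/(5.15) paired with test functions -/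

/-- The first Ward identity `Σ_μ Δ*_μ Π_{μν} = 0` for a complex kernel family (symbol side: (5.15)
`Σ_μ ∂_μ(−ζ)Π̃_{μν}(ζ) = 0`). [cite: Balaban1987RG1, (5.9)/(5.15) p.293] -/
def WardB (F : Fin d → Fin d → Pt d → ℂ) : Prop := ∀ ν x, ∑ μ, delta μ (F μ ν) x = 0

/-- **The Ward identity paired with a test function**: `Σ_μ (⟨Π_{μν}, φ(·+e_μ)⟩ − ⟨Π_{μν}, φ⟩) = 0`.
[cite: Balaban1987RG1, (5.9)/(5.15) p.293] -/
theorem ward_pair {a M : ℝ} (ha : 0 < a) {F : Fin d → Fin d → Pt d → ℂ} (hF : ∀ μ ν, ExpBound a M (F μ ν))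
    (hW : WardB F) (ν : Fin d) {φ : Pt d → ℂ} (hφ : PolyBound φ) :
    ∑ μ, (mom (F μ ν) (fun x => φ (x + unitVec μ)) - mom (F μ ν) φ) = 0 := by
  have h1 : ∀ μ, mom (F μ ν) (fun x => φ (x + unitVec μ)) - mom (F μ ν) φ = mom (delta μ (F μ ν)) φ :=
    fun μ => (mom_delta ha (hF μ ν) hφ μ).symm
  simp_rw [h1, mom]
  rw [← Summable.tsum_finsetSum (fun μ _ => hφ.summable_mul (delta_bound ha (hF μ ν) μ) ha)]
  simp_rw [← Finset.sum_mul, hW ν, zero_mul, tsum_zero]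

/-- **(W₀)** the Ward identity with `φ = u_κ`: all zeroth moments vanish, `Σ_u Π_{κν}(u) = 0`.
[cite: Balaban1987RG1, (5.9)/(5.15) p.293; (5.16) p.293 (no constant term)] -/
theorem m0_eq_zero_of_ward {a M : ℝ} (ha : 0 < a) {F : Fin d → Fin d → Pt d → ℂ}
    (hF : ∀ μ ν, ExpBound a M (F μ ν)) (hW : WardB F) (κ ν : Fin d) :
    mom (F κ ν) (fun _ => 1) = 0 := by
  have h := ward_pair ha hF hW ν (polyBound_coord κ)
  have key : ∀ μ, mom (F μ ν) (fun x => (((x + unitVec μ) κ : ℤ) : ℂ)) - mom (F μ ν) (fun x => ((x κ : ℤ) : ℂ))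
      = kron κ μ * mom (F μ ν) (fun _ => 1) := by
    intro μ
    have e : (fun x : Pt d => (((x + unitVec μ) κ : ℤ) : ℂ)) = fun x => ((x κ : ℤ) : ℂ) + kron κ μ * 1 := by
      funext x; simp only [Pi.add_apply, Int.cast_add, unitVec_cast, mul_one]
    rw [e, mom_add ha (hF μ ν) (polyBound_coord κ) ((polyBound_const 1).const_mul _), mom_const_mul]
    ring
  rw [Finset.sum_congr rfl fun μ _ => key μ] at h
  simp only [kron, ite_mul, one_mul, zero_mul, Finset.sum_ite_eq, Finset.mem_univ, if_true] at h
  exact h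

/-- The shifted cubic test function minus the cubic, paired with a kernel of vanishing zeroth and first moments:
`⟨c, (u+e_μ)_κ(u+e_μ)_λ(u+e_μ)_τ − u_κu_λu_τ⟩ = δ_{κμ}m₂(λ,τ) + δ_{λμ}m₂(κ,τ) + δ_{τμ}m₂(κ,λ)`. [folklore] -/
theorem mom_cubic_shift {a M : ℝ} (ha : 0 < a) {c : Pt d → ℂ} (hc : ExpBound a M c)
    (h0 : mom c (fun _ => 1) = 0) (h1 : ∀ i, mom c (fun x => ((x i : ℤ) : ℂ)) = 0) (μ κ τ σ : Fin d) :
    mom c (fun x => (((x + unitVec μ) κ : ℤ) : ℂ) * (((x + unitVec μ) τ : ℤ) : ℂ) * (((x + unitVec μ) σ : ℤ) : ℂ))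
      - mom c (fun x => ((x κ : ℤ) : ℂ) * ((x τ : ℤ) : ℂ) * ((x σ : ℤ) : ℂ))
      = kron κ μ * m2 c τ σ + kron τ μ * m2 c κ σ + kron σ μ * m2 c κ τ := by
  have pc : PolyBound fun x : Pt d => ((x κ : ℤ) : ℂ) * ((x τ : ℤ) : ℂ) * ((x σ : ℤ) : ℂ) :=
    ((polyBound_coord κ).mul (polyBound_coord τ)).mul (polyBound_coord σ)
  rw [← mom_sub ha hc (pc.shift (unitVec μ) (abs_unitVec_le μ)) pc]
  have e : (fun x : Pt d => (((x + unitVec μ) κ : ℤ) : ℂ) * (((x + unitVec μ) τ : ℤ) : ℂ) *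
        (((x + unitVec μ) σ : ℤ) : ℂ) - ((x κ : ℤ) : ℂ) * ((x τ : ℤ) : ℂ) * ((x σ : ℤ) : ℂ))
      = fun x => kron κ μ * (((x τ : ℤ) : ℂ) * ((x σ : ℤ) : ℂ)) + kron τ μ * (((x κ : ℤ) : ℂ) * ((x σ : ℤ) : ℂ))
          + kron σ μ * (((x κ : ℤ) : ℂ) * ((x τ : ℤ) : ℂ))
          + (kron κ μ * kron τ μ * ((x σ : ℤ) : ℂ) + kron κ μ * kron σ μ * ((x τ : ℤ) : ℂ)
              + kron τ μ * kron σ μ * ((x κ : ℤ) : ℂ) + kron κ μ * kron τ μ * kron σ μ * 1) := by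
    funext x
    simp only [Pi.add_apply, Int.cast_add, unitVec_cast]
    ring
  rw [e]
  have p1 : PolyBound fun x : Pt d => kron κ μ * (((x τ : ℤ) : ℂ) * ((x σ : ℤ) : ℂ)) :=
    ((polyBound_coord τ).mul (polyBound_coord σ)).const_mul _
  have p2 : PolyBound fun x : Pt d => kron τ μ * (((x κ : ℤ) : ℂ) * ((x σ : ℤ) : ℂ)) :=
    ((polyBound_coord κ).mul (polyBound_coord σ)).const_mul _
  have p3 : PolyBound fun x : Pt d => kron σ μ * (((x κ : ℤ) : ℂ) * ((x τ : ℤ) : ℂ)) :=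
    ((polyBound_coord κ).mul (polyBound_coord τ)).const_mul _
  have q1 : PolyBound fun x : Pt d => kron κ μ * kron τ μ * ((x σ : ℤ) : ℂ) := (polyBound_coord σ).const_mul _
  have q2 : PolyBound fun x : Pt d => kron κ μ * kron σ μ * ((x τ : ℤ) : ℂ) := (polyBound_coord τ).const_mul _
  have q3 : PolyBound fun x : Pt d => kron τ μ * kron σ μ * ((x κ : ℤ) : ℂ) := (polyBound_coord κ).const_mul _
  have q4 : PolyBound fun _ : Pt d => kron κ μ * kron τ μ * kron σ μ * (1 : ℂ) :=
    (polyBound_const 1).const_mul _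
  rw [mom_add ha hc ((p1.add p2).add p3) (((q1.add q2).add q3).add q4), mom_add ha hc (p1.add p2) p3,
    mom_add ha hc p1 p2, mom_add ha hc ((q1.add q2).add q3) q4, mom_add ha hc (q1.add q2) q3,
    mom_add ha hc q1 q2, mom_const_mul, mom_const_mul, mom_const_mul, mom_const_mul, mom_const_mul,
    mom_const_mul, mom_const_mul, h0, h1, h1, h1]
  simp only [m2, mul_zero, add_zero]

/-- **(W₂)** the Ward identity with `φ = u_κu_λu_τ` (given `m₀ = m₁ = 0`): the cyclic relation
`m₂(Π_{κν})(λ,τ) + m₂(Π_{λν})(κ,τ) + m₂(Π_{τν})(κ,λ) = 0`. [cite: Balaban1987RG1, (5.9)/(5.15) p.293] -/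
theorem ward_m2 {a M : ℝ} (ha : 0 < a) {F : Fin d → Fin d → Pt d → ℂ} (hF : ∀ μ ν, ExpBound a M (F μ ν))
    (hW : WardB F) (h0 : ∀ μ ν, mom (F μ ν) (fun _ => 1) = 0)
    (h1 : ∀ μ ν i, mom (F μ ν) (fun x => ((x i : ℤ) : ℂ)) = 0) (κ τ σ ν : Fin d) :
    m2 (F κ ν) τ σ + m2 (F τ ν) κ σ + m2 (F σ ν) κ τ = 0 := by
  have h := ward_pair ha hF hW ν (((polyBound_coord κ).mul (polyBound_coord τ)).mul (polyBound_coord σ))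
  rw [Finset.sum_congr rfl fun μ _ => mom_cubic_shift ha (hF μ ν) (h0 μ ν) (h1 μ ν) μ κ τ σ] at h
  simp only [kron, ite_mul, one_mul, zero_mul, Finset.sum_add_distrib, Finset.sum_ite_eq, Finset.mem_univ,
    if_true] at h
  exact h

/-! ## §3. The reflections (5.7)/(5.13) in the difference variable, and parity -/

/-- The half-bond twist `[μ = ρ] − [ν = ρ]` of the reflection of the axis `ρ` acting on the difference variable of
`Π_{μν}` ((5.7): `x' − y' = εu − ((1−ε_μ)/2)e_μ + ((1−ε_ν)/2)e_ν`, `(1−ε_j)/2 = [j = ρ]`).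
[cite: Balaban1987RG1, (5.7) p.293] -/
def tw (ρ μ ν : Fin d) : ℤ := (if μ = ρ then 1 else 0) - (if ν = ρ then 1 else 0)

/-- The twisted reflection `R_{ρ;μν}` of (5.7) on the difference variable: `(Ru)_ρ = −u_ρ − [μ=ρ] + [ν=ρ]`,
`(Ru)_j = u_j` for `j ≠ ρ`. [cite: Balaban1987RG1, (5.7) p.293] -/
def reflTwist (ρ μ ν : Fin d) (x : Pt d) : Pt d := Function.update x ρ (-x ρ - tw ρ μ ν)

/-- The `ρ`-component of the twisted reflection. [cite: Balaban1987RG1, (5.7) p.293] -/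
@[simp] theorem reflTwist_self (ρ μ ν : Fin d) (x : Pt d) : reflTwist ρ μ ν x ρ = -x ρ - tw ρ μ ν :=
  Function.update_self ..

/-- The other components of the twisted reflection. [cite: Balaban1987RG1, (5.7) p.293] -/
@[simp] theorem reflTwist_of_ne {ρ μ ν j : Fin d} (h : j ≠ ρ) (x : Pt d) : reflTwist ρ μ ν x j = x j :=
  Function.update_of_ne h ..

/-- The twisted reflection is an involution. [folklore] -/
theorem reflTwist_reflTwist (ρ μ ν : Fin d) (x : Pt d) : reflTwist ρ μ ν (reflTwist ρ μ ν x) = x := by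
  funext j
  by_cases hj : j = ρ
  · subst hj
    rw [reflTwist_self, reflTwist_self]
    ring
  · rw [reflTwist_of_ne hj, reflTwist_of_ne hj]

/-- The twisted reflection as a bijection of the lattice (used to re-index lattice sums). [folklore] -/
def reflEquiv (ρ μ ν : Fin d) : Pt d ≃ Pt d :=
  ⟨reflTwist ρ μ ν, reflTwist ρ μ ν, reflTwist_reflTwist ρ μ ν, reflTwist_reflTwist ρ μ ν⟩

/-- The sign `ε_i` of the reflection of the axis `ρ`: `−1` iff `i = ρ`. [cite: Balaban1987RG1, (5.7) p.293] -/
def rsgn (ρ i : Fin d) : ℝ := if i = ρ then -1 else 1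

/-- `ε_i(ρ) = −1` for `i = ρ`. [folklore] -/
theorem rsgn_self (ρ : Fin d) : rsgn ρ ρ = -1 := if_pos rfl

/-- `ε_i(ρ) = 1` for `i ≠ ρ`. [folklore] -/
theorem rsgn_of_ne {ρ i : Fin d} (h : i ≠ ρ) : rsgn ρ i = 1 := if_neg h

/-- **(5.7)/(5.13) typed**: covariance of the real kernel under the reflections of single axes (these generate all
`ε`), in the difference variable: `Π_{μν}(R_{ρ;μν}u) = ε_με_ν Π_{μν}(u)`. [cite: Balaban1987RG1, (5.7)/(5.13) p.293] -/
def ReflCovariant (P : B12Beta.Kernel d) : Prop :=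
  ∀ ρ μ ν x, P μ ν (reflTwist ρ μ ν x) = rsgn ρ μ * rsgn ρ ν * P μ ν x

/-- The doubled bond-midpoint coordinate `X_κ(u) = 2u_κ + [κ=μ] − [κ=ν]` (twice the `κ`-th coordinate of the
difference of the midpoints of the bonds `⟨x, x+e_μ⟩`, `⟨y, y+e_ν⟩`, `u = x − y`). [folklore] -/
def X (μ ν κ : Fin d) (x : Pt d) : ℂ := 2 * ((x κ : ℤ) : ℂ) + ((tw κ μ ν : ℤ) : ℂ)

/-- Midpoint coordinates transform WITHOUT twist: `X_κ(R_{ρ;μν}u) = ε_κ X_κ(u)`. [folklore] -/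
theorem X_reflTwist (ρ μ ν κ : Fin d) (x : Pt d) :
    X μ ν κ (reflTwist ρ μ ν x) = (rsgn ρ κ : ℂ) * X μ ν κ x := by
  unfold X rsgn
  by_cases hκ : κ = ρ
  · subst hκ
    rw [reflTwist_self, if_pos rfl]
    push_cast
    ring
  · rw [reflTwist_of_ne hκ, if_neg hκ]
    push_cast
    ring

/-- Re-indexing a paired lattice sum by the twisted reflection, using (5.7):
`⟨Π_{μν}, φ⟩ = ε_με_ν ⟨Π_{μν}, φ ∘ R_{ρ;μν}⟩`. [cite: Balaban1987RG1, (5.7) p.293] -/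
theorem mom_reflect {P : B12Beta.Kernel d} (hR : ReflCovariant P) (ρ μ ν : Fin d) (φ : Pt d → ℂ) :
    mom (ofReal (P μ ν)) φ =
      ((rsgn ρ μ * rsgn ρ ν : ℝ) : ℂ) * mom (ofReal (P μ ν)) (fun x => φ (reflTwist ρ μ ν x)) := by
  unfold mom
  calc ∑' x, ofReal (P μ ν) x * φ x
      = ∑' x, ofReal (P μ ν) (reflTwist ρ μ ν x) * φ (reflTwist ρ μ ν x) :=
        ((reflEquiv ρ μ ν).tsum_eq (fun x => ofReal (P μ ν) x * φ x)).symm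
    _ = ∑' x, ((rsgn ρ μ * rsgn ρ ν : ℝ) : ℂ) * (ofReal (P μ ν) x * φ (reflTwist ρ μ ν x)) :=
        tsum_congr fun x => by simp only [ofReal]; rw [hR ρ μ ν x]; push_cast; ring
    _ = _ := tsum_mul_left

/-- Parity of the first midpoint moment: `⟨Π_{μν}, X_κ⟩ = ε_με_νε_κ ⟨Π_{μν}, X_κ⟩` for every axis `ρ`. [folklore] -/
theorem momX_refl {P : B12Beta.Kernel d} (hR : ReflCovariant P) (ρ μ ν κ : Fin d) :
    mom (ofReal (P μ ν)) (X μ ν κ) =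
      ((rsgn ρ μ * rsgn ρ ν * rsgn ρ κ : ℝ) : ℂ) * mom (ofReal (P μ ν)) (X μ ν κ) := by
  conv_lhs => rw [mom_reflect hR ρ μ ν (X μ ν κ)]
  simp_rw [X_reflTwist]
  rw [mom_const_mul]
  push_cast
  ring

/-- Parity of the second midpoint moments: `⟨Π_{μν}, X_κX_τ⟩ = ε_με_νε_κε_τ ⟨Π_{μν}, X_κX_τ⟩`. [folklore] -/
theorem momXX_refl {P : B12Beta.Kernel d} (hR : ReflCovariant P) (ρ μ ν κ τ : Fin d) :
    mom (ofReal (P μ ν)) (fun x => X μ ν κ x * X μ ν τ x) =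
      ((rsgn ρ μ * rsgn ρ ν * rsgn ρ κ * rsgn ρ τ : ℝ) : ℂ) *
        mom (ofReal (P μ ν)) (fun x => X μ ν κ x * X μ ν τ x) := by
  conv_lhs => rw [mom_reflect hR ρ μ ν (fun x => X μ ν κ x * X μ ν τ x)]
  simp_rw [X_reflTwist]
  have e : (fun x : Pt d => (rsgn ρ κ : ℂ) * X μ ν κ x * ((rsgn ρ τ : ℂ) * X μ ν τ x)) =
      fun x => ((rsgn ρ κ : ℂ) * (rsgn ρ τ : ℂ)) * (X μ ν κ x * X μ ν τ x) := by
    funext x; ring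
  rw [e, mom_const_mul]
  push_cast
  ring

/-- **All first midpoint moments vanish**: for every `μ ν κ` some axis `ρ` meets an odd number of the three indices,
so the parity sign is `−1`. [folklore] -/
theorem momX_eq_zero {P : B12Beta.Kernel d} (hR : ReflCovariant P) (μ ν κ : Fin d) :
    mom (ofReal (P μ ν)) (X μ ν κ) = 0 := by
  obtain ⟨ρ, hρ⟩ : ∃ ρ, rsgn ρ μ * rsgn ρ ν * rsgn ρ κ = -1 := by
    by_cases h1 : μ = κ
    · subst h1
      by_cases h2 : ν = μ
      · subst h2
        exact ⟨ν, by rw [rsgn_self]; ring⟩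
      · exact ⟨ν, by rw [rsgn_self, rsgn_of_ne (Ne.symm h2)]; ring⟩
    · by_cases h2 : ν = κ
      · subst h2
        exact ⟨μ, by rw [rsgn_self, rsgn_of_ne (Ne.symm h1)]; ring⟩
      · exact ⟨κ, by rw [rsgn_self, rsgn_of_ne h1, rsgn_of_ne h2]; ring⟩
  have h := momX_refl hR ρ μ ν κ
  rw [hρ] at h
  push_cast at h
  have h2 : (2 : ℂ) * mom (ofReal (P μ ν)) (X μ ν κ) = 0 := by linear_combination h
  exact (mul_eq_zero.mp h2).resolve_left two_ne_zero

/-- **Second midpoint moments of odd parity vanish**: if some axis `ρ` meets an odd number of the four indices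
`μ ν κ τ`, then `⟨Π_{μν}, X_κX_τ⟩ = 0`. [folklore] -/
theorem momXX_eq_zero {P : B12Beta.Kernel d} (hR : ReflCovariant P) {μ ν κ τ : Fin d} (ρ : Fin d)
    (hρ : rsgn ρ μ * rsgn ρ ν * rsgn ρ κ * rsgn ρ τ = -1) :
    mom (ofReal (P μ ν)) (fun x => X μ ν κ x * X μ ν τ x) = 0 := by
  have h := momXX_refl hR ρ μ ν κ τ
  rw [hρ] at h
  push_cast at h
  have h2 : (2 : ℂ) * mom (ofReal (P μ ν)) (fun x => X μ ν κ x * X μ ν τ x) = 0 := by linear_combination h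
  exact (mul_eq_zero.mp h2).resolve_left two_ne_zero

/-- `⟨c, X_κ⟩ = 2m₁(κ) + ([κ=μ] − [κ=ν])m₀`. [folklore] -/
theorem momX_expand {a M : ℝ} (ha : 0 < a) {c : Pt d → ℂ} (hc : ExpBound a M c) (μ ν κ : Fin d) :
    mom c (X μ ν κ) = 2 * mom c (fun x => ((x κ : ℤ) : ℂ)) + ((tw κ μ ν : ℤ) : ℂ) * mom c (fun _ => 1) := by
  have e : X μ ν κ = fun x => 2 * ((x κ : ℤ) : ℂ) + ((tw κ μ ν : ℤ) : ℂ) * 1 := by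
    funext x; rw [X, mul_one]
  rw [e, mom_add ha hc ((polyBound_coord κ).const_mul 2) ((polyBound_const 1).const_mul _), mom_const_mul,
    mom_const_mul]

/-- `⟨c, X_κX_τ⟩ = 4m₂(κ,τ) + 2c_τ m₁(κ) + 2c_κ m₁(τ) + c_κc_τ m₀`, `c_j = [j=μ] − [j=ν]`. [folklore] -/
theorem momXX_expand {a M : ℝ} (ha : 0 < a) {c : Pt d → ℂ} (hc : ExpBound a M c) (μ ν κ τ : Fin d) :
    mom c (fun x => X μ ν κ x * X μ ν τ x) =
      4 * m2 c κ τ + 2 * ((tw τ μ ν : ℤ) : ℂ) * mom c (fun x => ((x κ : ℤ) : ℂ))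
        + 2 * ((tw κ μ ν : ℤ) : ℂ) * mom c (fun x => ((x τ : ℤ) : ℂ))
        + ((tw κ μ ν : ℤ) : ℂ) * ((tw τ μ ν : ℤ) : ℂ) * mom c (fun _ => 1) := by
  have e : (fun x => X μ ν κ x * X μ ν τ x) = fun x =>
      4 * (((x κ : ℤ) : ℂ) * ((x τ : ℤ) : ℂ)) + 2 * ((tw τ μ ν : ℤ) : ℂ) * ((x κ : ℤ) : ℂ)
        + 2 * ((tw κ μ ν : ℤ) : ℂ) * ((x τ : ℤ) : ℂ) + ((tw κ μ ν : ℤ) : ℂ) * ((tw τ μ ν : ℤ) : ℂ) * 1 := by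
    funext x; simp only [X]; ring
  have p1 : PolyBound fun x : Pt d => 4 * (((x κ : ℤ) : ℂ) * ((x τ : ℤ) : ℂ)) :=
    ((polyBound_coord κ).mul (polyBound_coord τ)).const_mul 4
  have p2 : PolyBound fun x : Pt d => 2 * ((tw τ μ ν : ℤ) : ℂ) * ((x κ : ℤ) : ℂ) :=
    (polyBound_coord κ).const_mul _
  have p3 : PolyBound fun x : Pt d => 2 * ((tw κ μ ν : ℤ) : ℂ) * ((x τ : ℤ) : ℂ) :=
    (polyBound_coord τ).const_mul _
  have p4 : PolyBound fun _ : Pt d => ((tw κ μ ν : ℤ) : ℂ) * ((tw τ μ ν : ℤ) : ℂ) * (1 : ℂ) :=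
    (polyBound_const 1).const_mul _
  rw [e, mom_add ha hc ((p1.add p2).add p3) p4, mom_add ha hc (p1.add p2) p3, mom_add ha hc p1 p2,
    mom_const_mul, mom_const_mul, mom_const_mul, mom_const_mul, m2]

/-! ## §4. Monomials of degree ≤ 2 and `TaylorData3` from the three moment identities -/

/-- A multi-index of degree `0` gives the monomial `1`. [folklore] -/
theorem monom_of_deg_eq_zero {γ : Fin d → ℕ} (h : deg γ = 0) (x : Pt d) : monom γ x = 1 := by
  have h0 : ∀ j, γ j = 0 := fun j => Nat.eq_zero_of_le_zero (h ▸ le_deg γ j)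
  simp [monom, h0]

/-- A multi-index of non-zero degree has a non-zero entry. [folklore] -/
theorem exists_ne_zero_of_deg_ne_zero {γ : Fin d → ℕ} (h : deg γ ≠ 0) : ∃ κ, γ κ ≠ 0 := by
  by_contra hc
  exact h (Finset.sum_eq_zero fun j _ => by
    by_contra hj
    exact hc ⟨j, hj⟩)

/-- Splitting one factor `x_κ` off a monomial. [folklore] -/
theorem monom_update {γ : Fin d → ℕ} {κ : Fin d} (h : γ κ ≠ 0) (x : Pt d) :
    monom γ x = ((x κ : ℤ) : ℂ) * monom (Function.update γ κ (γ κ - 1)) x := by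
  unfold monom
  rw [← Finset.mul_prod_erase Finset.univ (fun j => ((x j : ℤ) : ℂ) ^ γ j) (Finset.mem_univ κ),
    ← Finset.mul_prod_erase Finset.univ (fun j => ((x j : ℤ) : ℂ) ^ Function.update γ κ (γ κ - 1) j)
      (Finset.mem_univ κ)]
  have hrest : ∏ j ∈ Finset.univ.erase κ, ((x j : ℤ) : ℂ) ^ Function.update γ κ (γ κ - 1) j =
      ∏ j ∈ Finset.univ.erase κ, ((x j : ℤ) : ℂ) ^ γ j :=
    Finset.prod_congr rfl fun j hj => by rw [Function.update_of_ne (Finset.ne_of_mem_erase hj)]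
  rw [hrest, Function.update_self, ← mul_assoc, ← pow_succ']
  congr 2
  omega

/-- The degree drops by one when a factor is split off. [folklore] -/
theorem deg_update {γ : Fin d → ℕ} {κ : Fin d} (h : γ κ ≠ 0) :
    deg (Function.update γ κ (γ κ - 1)) + 1 = deg γ := by
  unfold deg
  rw [Finset.sum_update_of_mem (Finset.mem_univ κ), Finset.sdiff_singleton_eq_erase,
    ← Finset.add_sum_erase Finset.univ γ (Finset.mem_univ κ)]
  omega

/-- **Classification of the monomials of degree ≤ 2**: `1`, `x_κ`, or `x_κx_τ`. [folklore] -/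
theorem monom_cases {γ : Fin d → ℕ} (hγ : deg γ < 3) :
    (∀ x : Pt d, monom γ x = 1) ∨ (∃ κ, ∀ x : Pt d, monom γ x = ((x κ : ℤ) : ℂ)) ∨
      (∃ κ τ, ∀ x : Pt d, monom γ x = ((x κ : ℤ) : ℂ) * ((x τ : ℤ) : ℂ)) := by
  by_cases h0 : deg γ = 0
  · exact Or.inl (monom_of_deg_eq_zero h0)
  obtain ⟨κ, hκ⟩ := exists_ne_zero_of_deg_ne_zero h0
  have hd1 := deg_update hκ
  by_cases h1 : deg (Function.update γ κ (γ κ - 1)) = 0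
  · exact Or.inr (Or.inl ⟨κ, fun x => by rw [monom_update hκ, monom_of_deg_eq_zero h1, mul_one]⟩)
  obtain ⟨τ, hτ⟩ := exists_ne_zero_of_deg_ne_zero h1
  have hd2 := deg_update hτ
  have h2 : deg (Function.update (Function.update γ κ (γ κ - 1)) τ
      (Function.update γ κ (γ κ - 1) τ - 1)) = 0 := by omega
  exact Or.inr (Or.inr ⟨κ, τ, fun x => by
    rw [monom_update hκ, monom_update hτ, monom_of_deg_eq_zero h2, mul_one]⟩)

/-- **`TaylorData3` from the three moment identities** `m₀ = 0`, `m₁ ≡ 0`,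
`m₂(κ,τ) = β(−2δ_{μν}δ_{τκ} + δ_{κμ}δ_{τν} + δ_{κν}δ_{τμ})` (the table of `wilsonQ μ ν`).
[cite: Balaban1987RG1, (5.16) p.293 / (5.36), (5.42) p.297] -/
theorem taylorData3_of_moments {P : Pt d → ℂ} {β : ℂ} {μ ν : Fin d} (h0 : ∑' x, P x = 0)
    (h1 : ∀ κ, ∑' x : Pt d, P x * ((x κ : ℤ) : ℂ) = 0)
    (h2 : ∀ κ τ, ∑' x : Pt d, P x * (((x κ : ℤ) : ℂ) * ((x τ : ℤ) : ℂ)) =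
      β * (-(2 * kron μ ν * kron τ κ) + kron κ μ * kron τ ν + kron κ ν * kron τ μ)) :
    TaylorData3 β μ ν P := by
  intro γ hγ
  rcases monom_cases hγ with h | ⟨κ, h⟩ | ⟨κ, τ, h⟩
  · simp_rw [h, mul_one]
    rw [h0, tsum_wilsonQ, mul_zero]
  · simp_rw [h]
    rw [h1, tsum_wilsonQ_mul_coord, mul_zero]
  · simp_rw [h]
    rw [h2, tsum_wilsonQ_mul_coord2]

/-! ## §5. Assembly: (5.7) + (5.6) + (5.9)₁ + (5.10) ⇒ the second-order Taylor data (5.16)/(5.36) with β = (5.42) -/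

/-- **(5.9)/(5.15) typed**, first identity, for the real kernel: `Σ_μ (Π_{μν}(u − e_μ) − Π_{μν}(u)) = 0`
(`Σ_μ ∂*_μΠ_{μν} = 0`; symbol side `Σ_μ ∂_μ(−ζ)Π̃_{μν}(ζ) = 0`). [cite: Balaban1987RG1, (5.9)/(5.15) p.293] -/
def WardFirst (P : B12Beta.Kernel d) : Prop := ∀ ν x, ∑ μ, (P μ ν (x - unitVec μ) - P μ ν x) = 0

/-- The real Ward identity gives the complex one for the kernel read in `ℂ`. [folklore] -/
theorem wardB_ofReal {P : B12Beta.Kernel d} (h : WardFirst P) : WardB fun μ ν => ofReal (P μ ν) := by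
  intro ν x
  have := h ν x
  simp only [delta, ofReal]
  exact_mod_cast this

/-- The complex second moment of a real component is the cell's `B12Beta.secondMoment` read in `ℂ`.
[cite: Balaban1987RG1, (1.22) p.264 / (5.42) p.297] -/
theorem m2_ofReal_eq_secondMoment (P : B12Beta.Kernel d) (μ ν : Fin d) :
    m2 (ofReal (P μ ν)) μ ν = ((B12Beta.secondMoment P μ ν : ℝ) : ℂ) := by
  rw [m2, mom, B12Beta.secondMoment, Complex.ofReal_tsum]
  exact tsum_congr fun x => by simp only [ofReal]; push_cast; ring

/-- The index table: a function `m(μ,ν,κ,τ)` symmetric in `(κ,τ)`, vanishing whenever some axis meets an odd number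
of the four indices, with `m(a,a,a,a) = 0`, `m(b,b,a,a) = −2β` and `m(a,b,a,b) = β` for `a ≠ b`, is
`β(−2δ_{μν}δ_{τκ} + δ_{κμ}δ_{τν} + δ_{κν}δ_{τμ})`. [folklore] -/
theorem table536 {m : Fin d → Fin d → Fin d → Fin d → ℂ} {β : ℂ}
    (hsym : ∀ μ ν κ τ, m μ ν κ τ = m μ ν τ κ)
    (hpar : ∀ μ ν κ τ ρ, rsgn ρ μ * rsgn ρ ν * rsgn ρ κ * rsgn ρ τ = -1 → m μ ν κ τ = 0)
    (hdiag : ∀ a, m a a a a = 0) (hcross : ∀ a b, a ≠ b → m b b a a = -2 * β)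
    (hoff : ∀ a b, a ≠ b → m a b a b = β) (μ ν κ τ : Fin d) :
    m μ ν κ τ = β * (-(2 * kron μ ν * kron τ κ) + kron κ μ * kron τ ν + kron κ ν * kron τ μ) := by
  by_cases hμν : μ = ν
  · subst hμν
    by_cases hκτ : κ = τ
    · subst hκτ
      by_cases hκμ : κ = μ
      · subst hκμ
        rw [hdiag, kron_self]
        ring
      · have hμκ : μ ≠ κ := fun h => hκμ h.symm
        rw [hcross κ μ hκμ, kron_self, kron_self, kron_of_ne hκμ]
        ring
    · have hτκ : τ ≠ κ := fun h => hκτ h.symm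
      have hsgn : rsgn κ μ * rsgn κ μ * rsgn κ κ * rsgn κ τ = -1 := by
        rw [rsgn_self, rsgn_of_ne hτκ]
        by_cases hμκ : μ = κ
        · rw [hμκ, rsgn_self]; ring
        · rw [rsgn_of_ne hμκ]; ring
      rw [hpar μ μ κ τ κ hsgn, kron_of_ne hτκ]
      by_cases hκμ : κ = μ
      · have hτμ : τ ≠ μ := fun h => hτκ (h.trans hκμ.symm)
        rw [kron_of_ne hτμ]
        ring
      · rw [kron_of_ne hκμ]
        ring
  · have hνμ : ν ≠ μ := fun h => hμν h.symm
    rw [kron_of_ne hμν]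
    by_cases hκμ : κ = μ
    · subst hκμ
      rw [kron_self, kron_of_ne hμν]
      by_cases hτν : τ = ν
      · subst hτν
        rw [hoff κ τ hμν, kron_self]
        ring
      · have hsgn : rsgn ν κ * rsgn ν ν * rsgn ν κ * rsgn ν τ = -1 := by
          rw [rsgn_self, rsgn_of_ne hμν, rsgn_of_ne hτν]; ring
        rw [hpar κ ν κ τ ν hsgn, kron_of_ne hτν]
        ring
    · rw [kron_of_ne hκμ]
      by_cases hκν : κ = ν
      · subst hκν
        rw [kron_self]
        by_cases hτμ : τ = μ
        · subst hτμ
          rw [hsym, hoff τ κ hμν, kron_self]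
          ring
        · have hsgn : rsgn μ μ * rsgn μ κ * rsgn μ κ * rsgn μ τ = -1 := by
            rw [rsgn_self, rsgn_of_ne hκμ, rsgn_of_ne hτμ]; ring
          rw [hpar μ κ κ τ μ hsgn, kron_of_ne hτμ]
          ring
      · rw [kron_of_ne hκν]
        by_cases hτκ : τ = κ
        · subst hτκ
          have hsgn : rsgn μ μ * rsgn μ ν * rsgn μ τ * rsgn μ τ = -1 := by
            rw [rsgn_self, rsgn_of_ne hνμ, rsgn_of_ne hκμ]; ring
          rw [hpar μ ν τ τ μ hsgn]
          ring
        · have hμκ : μ ≠ κ := fun h => hκμ h.symm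
          have hνκ : ν ≠ κ := fun h => hκν h.symm
          have hsgn : rsgn κ μ * rsgn κ ν * rsgn κ κ * rsgn κ τ = -1 := by
            rw [rsgn_self, rsgn_of_ne hμκ, rsgn_of_ne hνκ, rsgn_of_ne hτκ]; ring
          rw [hpar μ ν κ τ κ hsgn]
          ring

/-- **B12 §5, second-order part of (5.16)/(5.36) with (5.42), from the printed symmetries alone.**  For a real kernel
family with the decay (5.10) of every component, the permutation covariance (5.6)/(5.12), the reflection
covariance (5.7)/(5.13) and the first Ward identity (5.9)/(5.15): every component `Π_{μν}` has second-order Taylor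
data `β ×` those of `δ_{μν}Δ − \overline{∂_μ}∂_ν`, with `β = Σ_x Π_{μ₀ν₀}(x)x_{μ₀}x_{ν₀}` for any fixed `μ₀ ≠ ν₀`.
[cite: Balaban1987RG1, (5.16) p.293; (5.36), (5.42) p.297] -/
theorem taylorData3_of_symmetries {P : B12Beta.Kernel d} {C δ₁ : ℝ} (hδ : 0 < δ₁)
    (h510 : ∀ μ ν, B12Sec2to5.Decay510 (P μ ν) C δ₁) (hperm : B12Beta.PermCovariant P)
    (hrefl : ReflCovariant P) (hward : WardFirst P) {μ₀ ν₀ : Fin d} (h0 : μ₀ ≠ ν₀) (μ ν : Fin d) :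
    TaylorData3 ((B12Beta.secondMoment P μ₀ ν₀ : ℝ) : ℂ) μ ν (ofReal (P μ ν)) := by
  have hE : ∀ μ ν : Fin d, ExpBound δ₁ C (ofReal (P μ ν)) := fun μ ν => expBound_of_decay510 (h510 μ ν)
  have hW : WardB fun μ ν => ofReal (P μ ν) := wardB_ofReal hward
  have S0 : ∀ μ ν : Fin d, mom (ofReal (P μ ν)) (fun _ => 1) = 0 :=
    fun μ ν => m0_eq_zero_of_ward (F := fun μ ν => ofReal (P μ ν)) hδ hE hW μ ν
  have S1 : ∀ μ ν κ : Fin d, mom (ofReal (P μ ν)) (fun x => ((x κ : ℤ) : ℂ)) = 0 := by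
    intro μ ν κ
    have h := momX_eq_zero hrefl μ ν κ
    rw [momX_expand hδ (hE μ ν), S0, mul_zero, add_zero] at h
    exact (mul_eq_zero.mp h).resolve_left two_ne_zero
  have S2 : ∀ μ ν κ τ ρ : Fin d, rsgn ρ μ * rsgn ρ ν * rsgn ρ κ * rsgn ρ τ = -1 →
      m2 (ofReal (P μ ν)) κ τ = 0 := by
    intro μ ν κ τ ρ hρ
    have h := momXX_eq_zero hrefl ρ hρ
    rw [momXX_expand hδ (hE μ ν), S0, S1, S1] at h
    simp only [mul_zero, add_zero] at h
    exact (mul_eq_zero.mp h).resolve_left (by norm_num)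
  have S3 : ∀ κ τ σ ν : Fin d, m2 (ofReal (P κ ν)) τ σ + m2 (ofReal (P τ ν)) κ σ + m2 (ofReal (P σ ν)) κ τ = 0 :=
    fun κ τ σ ν => ward_m2 (F := fun μ ν => ofReal (P μ ν)) hδ hE hW S0 S1 κ τ σ ν
  have Ssym : ∀ μ ν κ τ : Fin d, m2 (ofReal (P μ ν)) κ τ = m2 (ofReal (P μ ν)) τ κ :=
    fun μ ν κ τ => tsum_congr fun x => by ring
  have S4 : ∀ a : Fin d, m2 (ofReal (P a a)) a a = 0 := by
    intro a
    have h := S3 a a a a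
    have h3 : (3 : ℂ) * m2 (ofReal (P a a)) a a = 0 := by linear_combination h
    exact (mul_eq_zero.mp h3).resolve_left three_ne_zero
  have S6 : ∀ a b : Fin d, a ≠ b → m2 (ofReal (P a b)) a b = ((B12Beta.secondMoment P μ₀ ν₀ : ℝ) : ℂ) := by
    intro a b hab
    rw [m2_ofReal_eq_secondMoment, B12Beta.secondMoment_pair_indep hperm h0 hab]
  have S5 : ∀ a b : Fin d, a ≠ b → m2 (ofReal (P b b)) a a = -2 * ((B12Beta.secondMoment P μ₀ ν₀ : ℝ) : ℂ) := by
    intro a b hab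
    have h := S3 a a b b
    rw [S6 a b hab] at h
    linear_combination h
  refine taylorData3_of_moments (by simpa [mom] using S0 μ ν) (fun κ => S1 μ ν κ) fun κ τ => ?_
  exact table536 (m := fun μ ν κ τ => m2 (ofReal (P μ ν)) κ τ) Ssym S2 S4 S5 S6 μ ν κ τ

/-- **Corollary: (5.37)/(5.38) with (5.44) for every component, β = (1.22)/(5.42), from (5.6), (5.7), (5.9)₁ and
(5.10) alone** (via `B12Rep537.rep538_of_decay510`): `Π_{μν}(x) − βQ_{μν}(x) = Σ_{(κ,λ,ρ)} (Δ*_κΔ*_λΔ*_ρ Π′)(x)`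
with `|Π′(x)| ≤ K(δ₁,d)³(C + |β|MQ(δ₁,d)) e^{−δ₁|x|₁}`.
[cite: Balaban1987RG1, (5.37)–(5.38), (5.42), (5.44) p.297] -/
theorem rep538_of_symmetries {P : B12Beta.Kernel d} {C δ₁ : ℝ} (hδ : 0 < δ₁)
    (h510 : ∀ μ ν, B12Sec2to5.Decay510 (P μ ν) C δ₁) (hperm : B12Beta.PermCovariant P)
    (hrefl : ReflCovariant P) (hward : WardFirst P) {μ₀ ν₀ : Fin d} (h0 : μ₀ ≠ ν₀) (μ ν : Fin d) :
    (∀ x, (P μ ν x : ℂ) - ((B12Beta.secondMoment P μ₀ ν₀ : ℝ) : ℂ) * wilsonQ μ ν x =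
        ∑ μs : Fin 3 → Fin d, deltaIter 3 μs
          (rem538 (ofReal (P μ ν)) ((B12Beta.secondMoment P μ₀ ν₀ : ℝ) : ℂ) μ ν μs) x) ∧
      ∀ (μs : Fin 3 → Fin d) (x : Pt d),
        ‖rem538 (ofReal (P μ ν)) ((B12Beta.secondMoment P μ₀ ν₀ : ℝ) : ℂ) μ ν μs x‖ ≤
          K δ₁ d ^ 3 * (C + ‖((B12Beta.secondMoment P μ₀ ν₀ : ℝ) : ℂ)‖ * MQ δ₁ d) * Real.exp (-δ₁ * l1 x) :=
  rep538_of_decay510 hδ (h510 μ ν) (taylorData3_of_symmetries hδ h510 hperm hrefl hward h0 μ ν)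

end

end Literature.MathematicalPhysics.QuantumFieldTheory.Balaban1983to89.B12Transverse536
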